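import Summits.HodgeConjecture.HodgeConjecture.Theorems.Ring2AbelianAllWeilDiscriminantDescent
import HarnessLib

/-!
# Ring 2 · AbelianAll (ab-weil-1, gen 6), part B — the typed Weil components `(n, d, δ)` depend only on
  `(n, ℚ(√-d), δ)`: the cells `(n, m²d, δ)` and `(n, d, δ)` coincide, modulo one print fact

research route, not a corollary; conditional on HC_CM plus one named minimal statement.
Cell line: research route conditional on HC_CM; not a corollary; Q11.4-sentence-2 already refuted in dim ≥ 3.
`HC_CM` (`Theses.RankFourFaces.CMAbelianHodge`) does not occur in this file. No case of the Hodge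
conjecture is claimed: every statement below is an IMPLICATION or EQUIVALENCE between open statements,
unconditionally or under the typed print obligation `HyperplanePullbackAlongIsogeny` of gen 5
(Hartshorne II 7.6, III Ex. 5.7 (d); a HYPOTHESIS, never asserted) and refereed named facts taken as
hypotheses. `[M25]` (Markman 2025, unrefereed) is not used.

Part A (`Ring2AbelianAllWeilDiscriminantDescent`) proved that the non-degenerate discriminant class
`det H = δ` (`VanGeemen1994.HasWeilDiscriminantNondeg`) is invariant under `K`-equivariant isogenies and
that `(B, mψ, m²d)` has class `δ` iff `(B, ψ, d)` has class `congr δ` under the canonical identification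
`weilNormResidueGroupCongr : ℚˣ/Nm(K_{m²d}ˣ) = ℚˣ/Nm(K_dˣ)`. Consequences for the class targets
`Ring2.Hypotheses.WeilClassesComponent n d δ` (gen 5, §5 "out of scope", now closed):

* DOWNWARD, free: `weilClassesComponent_of_sq_mul` — the cell `(n, m²d, δ)` implies the cell
  `(n, d, congr δ)` (same variety, `φ ↦ mφ`); all classes at once `forall_weilClassesComponent_of_sq_mul`;
* UPWARD, modulo the print obligation: `weilClassesComponent_sq_mul` (descend along
  `A → B = A/φ'(A[m])`, `exists_isogeny_sq_descent'`; the hyperplane class of `B` comes from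
  `HyperplanePullbackAlongIsogeny`); hence `weilClassesComponent_sq_class_iff` — **the cell `(n, m²d, δ)`
  IS the cell `(n, d, congr δ)`**: the typed δ-table is indexed by `(n, K, det H)`, exactly as van Geemen's
  4.14 / Markman's habitat `(K, 2n, det H)` — and `weilClassesByComponent_iff_squarefree`;
* the columns: split cells `forall_split_components_iff_squarefree`, non-split cells CLASS BY CLASS
  `forall_nonsplit_components_iff_squarefree` (gen 5 re-indexed the non-split RUNG as a whole);
* the fourfold residual: `weilFourfoldResidual_iff_residualSq` — R1 `WeilFourfoldResidual` (all
  `d ∉ {1,3}`) and R1′ `WeilFourfoldResidualSq` (squarefree `d ∉ {1,3}`) are EQUIVALENT granted the print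
  obligation and the refereed sixfold facts of Koike (`d₀ = 1`) and Schoen (`d₀ = 3`) — whose columns go up
  the squares FREE of the obligation (gen 4) — replacing gen 4's route through Landherr, Markman 2023 and
  Lemma 5.2 (1) (`weilFourfoldResidual_of_refereed_and_residualSq`).

## References
* B. van Geemen, *An introduction to the Hodge conjecture for abelian varieties*, LNM 1594 (1994),
  4.14, Lemma 5.2 (2)–(3), 5.4–5.6. [vanGeemen1994HodgeAV]
* D. Mumford, *Abelian Varieties* (1970), §7 Thm. 4 p. 72, §19 Thm. 3. [MumfordAV1970]
* R. Hartshorne, *Algebraic Geometry* (1977), II Thm. 7.6, III Ex. 5.7 (d), App. A §3. [Hartshorne1977]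
* B. Moonen, Yu. Zarhin, *Weil classes on abelian varieties*, Crelle 496 (1998), §1. [MoonenZarhin1998WeilClasses]
* K. Koike, *Algebraicity of some Weil Hodge classes*, Canad. Math. Bull. 47 (2004), Rem. 2.1. [Koike2004WeilHodge]
* C. Schoen, *Addendum to: Hodge classes on self-products of a variety with an automorphism*,
  Compositio Math. 114 (1998), §10. [Schoen1998HodgeWeilAddendum]
-/

noncomputable section

set_option linter.dupNamespace false

open CategoryTheory Polynomial
open Literature.AlgebraicGeometry Literature.AlgebraicGeometry.Motives
open Literature.AlgebraicGeometry.HodgeTheory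
open Literature.AlgebraicGeometry.VanGeemen1994
open Literature.AlgebraicTopology.SingularHomology
open Summit.HodgeConjecture.HodgeConjecture.Cruxes.HodgeAbelianVarieties.EStepSecantInduction
open Summit.HodgeConjecture.HodgeConjecture.WeilTypeLadder
open Summit.HodgeConjecture.HodgeConjecture.Ring2.Hypotheses
open Summit.HodgeConjecture.HodgeConjecture.Ring2.Habitat

namespace Summit.HodgeConjecture.HodgeConjecture.Ring2.AbelianAll

/-! ### §3 The discriminant-indexed class targets along the descent -/

/-- **DOWNWARD, free: the cell `(n, m²d, δ)` implies the cell `(n, d, congr δ)`** (`m, d ≥ 1`). On the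
SAME variety: `(A, φ, d)` polarized by `d·e^*a + φ^*e^*a` with class `congr δ` is `(A, mφ, m²d)` polarized
by `m²d·e^*a + (mφ)^*e^*a` with class `δ`, with the same Weil plane (`weilClassesOf_zsmul_sq_mul`).
[cite: vanGeemen1994HodgeAV, Lemma 5.2 (3)] [cite: MoonenZarhin1998WeilClasses, §1] -/
theorem weilClassesComponent_of_sq_mul {n m d : ℕ} (hm : m ≠ 0) (hd : 0 < d)
    {δ : weilNormResidueGroup (m ^ 2 * d)} (hW : WeilClassesComponent n (m ^ 2 * d) δ) :
    WeilClassesComponent n d (weilNormResidueGroupCongr hm d δ) := by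
  intro A φ hA hX hφ e a ha ha0 hdisc c hrat hhodge hcW
  have hφ' : ((m : ℤ) • φ) ≫ ((m : ℤ) • φ) = -((m ^ 2 * d) • 𝟙 A) := by
    rw [Preadditive.zsmul_comp, Preadditive.comp_zsmul, hφ, natCast_zsmul, natCast_zsmul, smul_neg,
      smul_neg, smul_smul, smul_smul, show m * m * d = m ^ 2 * d by ring]
  exact hW A ((m : ℤ) • φ) hA hX hφ' e a ha ha0
    ((hasWeilDiscriminantNondeg_symmetrised_natCast_zsmul_iff hm _).2 hdisc) c hrat hhodge
    (by rwa [weilClassesOf_zsmul_sq_mul hm hd.ne' hφ])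

/-- **UPWARD, modulo the print obligation: the cell `(n, d, congr δ)` implies the cell `(n, m²d, δ)`**
(`m, d ≥ 1`). Given `(A, φ', m²d)` polarized by `h = m²d·e^*a + φ'^*e^*a` with class `δ`, descend to
`(B, ψ, d)` along `f : B → A`, `f ≫ φ' = mψ ≫ f` (`exists_isogeny_sq_descent'`): `(B, mψ, m²d, f^*h)` has
class `δ` (`det H` is an isogeny invariant), `f^*h = m²·(d·y + ψ^*y)` with `y = f^*e^*a`, so
`(B, ψ, d, d·y + ψ^*y)` has class `congr δ`, hence so has `d·e'^*a' + ψ^*e'^*a'` for the hyperplane class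
`e'^*a' = c·y` of `B` supplied by `HyperplanePullbackAlongIsogeny`; the cell at `(n, d, congr δ)` makes
the Weil classes of `(B, ψ)` algebraic and `weilAlgebraicFor_of_descent` brings them back to `A`.
[cite: vanGeemen1994HodgeAV, Lemma 5.2 (3)] [cite: Hartshorne1977, III Ex. 5.7 (d)]
[cite: MumfordAV1970, §7 Thm. 4 p. 72] -/
theorem weilClassesComponent_sq_mul (H : HyperplanePullbackAlongIsogeny) {n m d : ℕ} (hm : m ≠ 0)
    (hd : 0 < d) {δ : weilNormResidueGroup (m ^ 2 * d)}
    (hW : WeilClassesComponent n d (weilNormResidueGroupCongr hm d δ)) :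
    WeilClassesComponent n (m ^ 2 * d) δ := by
  intro A φ' hA hX hφ' e a ha ha0 hdisc c' hrat hhodge hc'W
  obtain ⟨B, p, f, ψ, hp, hfi, hf, -, hψ, hfφ, -⟩ := exists_isogeny_sq_descent' hm hφ'
  have hB : B.dim = 2 * n := (AbelianVariety.dim_eq_of_isIsogenous_holds ⟨p, hp⟩).symm.trans hA
  -- `(B, ψ, d)` has class `congr δ` for `d·y + ψ^*y`, `y = f^*e^*a`
  have h₁ := (hasWeilDiscriminantNondeg_iff_of_isIsogeny hfi hfφ).1 hdisc
  rw [map_symmetrised_of_comm f hfφ, hasWeilDiscriminantNondeg_symmetrised_natCast_zsmul_iff hm] at h₁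
  -- the hyperplane class `e'^*a' = c·y` of `B`
  obtain ⟨e', a', c, ha', ha'0, hc, he'⟩ := H A B f hfi e a ha ha0
  have h₂ : HasWeilDiscriminantNondeg B ψ n d ((d : ℂ) • complexBetti.map e'.ι 2 a' +
      complexBetti.map ψ.hom.hom.hom 2 (complexBetti.map e'.ι 2 a')) (weilNormResidueGroupCongr hm d δ) := by
    rw [he', map_smul, smul_comm (d : ℂ) (c : ℂ), ← smul_add]
    exact (hasWeilDiscriminantNondeg_ratCast_smul_iff hc).2 h₁
  have hWB : WeilAlgebraicFor n d B ψ := fun c hcW hrat hhodge =>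
    hW B ψ hB (isSmoothProjective_of_dim_eq' hB) hψ e' a' ha' ha'0 h₂ c hrat hhodge hcW
  exact weilAlgebraicFor_of_descent hm hd.ne' hA hp hf hψ hfφ hWB c' hc'W hrat hhodge

/-- **The cell `(n, m²d, δ)` IS the cell `(n, d, congr δ)`, modulo the print obligation** (`m, d ≥ 1`):
the typed δ-table `WeilClassesComponent` is indexed by `(n, K = ℚ(√-d), det H)`, as van Geemen's and
Markman's habitat `(K, 2n, det H)`. [cite: vanGeemen1994HodgeAV, 4.14 and Lemma 5.2 (3)] -/
theorem weilClassesComponent_sq_class_iff (H : HyperplanePullbackAlongIsogeny) {n m d : ℕ} (hm : m ≠ 0)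
    (hd : 0 < d) {δ : weilNormResidueGroup (m ^ 2 * d)} :
    WeilClassesComponent n (m ^ 2 * d) δ ↔ WeilClassesComponent n d (weilNormResidueGroupCongr hm d δ) :=
  ⟨weilClassesComponent_of_sq_mul hm hd, weilClassesComponent_sq_mul H hm hd⟩

/-- DOWNWARD, free, all classes at once: the `(n, m²d)`-row of the δ-table gives the `(n, d)`-row.
[cite: vanGeemen1994HodgeAV, Lemma 5.2 (3)] -/
theorem forall_weilClassesComponent_of_sq_mul {n m d : ℕ} (hm : m ≠ 0) (hd : 0 < d)
    (h : ∀ δ : weilNormResidueGroup (m ^ 2 * d), WeilClassesComponent n (m ^ 2 * d) δ)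
    (δ' : weilNormResidueGroup d) : WeilClassesComponent n d δ' := by
  obtain ⟨δ, rfl⟩ := (weilNormResidueGroupCongr hm d).surjective δ'
  exact weilClassesComponent_of_sq_mul hm hd (h δ)

/-- The `(n, m²d)`-row of the δ-table ↔ the `(n, d)`-row, modulo the print obligation.
[cite: vanGeemen1994HodgeAV, Lemma 5.2 (3)] -/
theorem forall_weilClassesComponent_sq_class_iff (H : HyperplanePullbackAlongIsogeny) {n m d : ℕ}
    (hm : m ≠ 0) (hd : 0 < d) :
    (∀ δ : weilNormResidueGroup (m ^ 2 * d), WeilClassesComponent n (m ^ 2 * d) δ) ↔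
      ∀ δ' : weilNormResidueGroup d, WeilClassesComponent n d δ' :=
  ⟨forall_weilClassesComponent_of_sq_mul hm hd, fun h _ => weilClassesComponent_sq_mul H hm hd (h _)⟩

/-- **`WeilClassesByComponent` needs squarefree `d` only, modulo the print obligation** (`d = b²a`).
[cite: vanGeemen1994HodgeAV, Lemma 5.2 (3)] [cite: MoonenZarhin1998WeilClasses, §1] -/
theorem weilClassesByComponent_iff_squarefree (H : HyperplanePullbackAlongIsogeny) :
    WeilClassesByComponent ↔
      ∀ (n : ℕ), 2 ≤ n → ∀ (d : ℕ), 0 < d → Squarefree d →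
        ∀ δ : weilNormResidueGroup d, WeilClassesComponent n d δ := by
  refine ⟨fun h n hn d hd _ δ => h n hn d hd δ, fun h n hn d hd δ => ?_⟩
  obtain ⟨a, b, ha, hb, rfl, hsq⟩ := Nat.sq_mul_squarefree_of_pos hd
  exact weilClassesComponent_sq_mul H hb.ne' ha (h n hn a ha hsq _)

/-- The SPLIT cell `(n, m²d, (-1)ⁿ)` ↔ the split cell `(n, d, (-1)ⁿ)`, modulo the print obligation (the
hyperbolic slices of gen 5, now through `det H = (-1)ⁿ` rather than `IsHyperbolicWeilType`; the two agree
granted Landherr, `LandherrSplitCriterion`, not used here). [cite: vanGeemen1994HodgeAV, 5.4 and (5.4.1)] -/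
theorem weilClassesComponent_split_sq_class_iff (H : HyperplanePullbackAlongIsogeny) {n m d : ℕ}
    (hm : m ≠ 0) (hd : 0 < d) :
    WeilClassesComponent n (m ^ 2 * d) (splitDiscriminantClass n (m ^ 2 * d)) ↔
      WeilClassesComponent n d (splitDiscriminantClass n d) := by
  rw [weilClassesComponent_sq_class_iff H hm hd, weilNormResidueGroupCongr_splitDiscriminantClass]

/-- **The split column by squarefree `d`**, modulo the print obligation: for any set of half-dimensions,
`(∀ d ≥ 1, cell (n, d, (-1)ⁿ)) ↔ (∀ squarefree d ≥ 1, …)`; with `4 ≤ n` this is rung R2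
`SplitWeilAbelianVarieties` granted Landherr (W4, `splitWeilAbelianVarieties_iff_split_components`).
[cite: vanGeemen1994HodgeAV, (5.4.1)] [cite: MoonenZarhin1998WeilClasses, §1] -/
theorem forall_split_components_iff_squarefree (H : HyperplanePullbackAlongIsogeny) (P : ℕ → Prop) :
    (∀ (n : ℕ), P n → ∀ (d : ℕ), 0 < d → WeilClassesComponent n d (splitDiscriminantClass n d)) ↔
      ∀ (n : ℕ), P n → ∀ (d : ℕ), 0 < d → Squarefree d →
        WeilClassesComponent n d (splitDiscriminantClass n d) := by
  refine ⟨fun h n hn d hd _ => h n hn d hd, fun h n hn d hd => ?_⟩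
  obtain ⟨a, b, ha, hb, rfl, hsq⟩ := Nat.sq_mul_squarefree_of_pos hd
  exact (weilClassesComponent_split_sq_class_iff H hb.ne' ha).2 (h n hn a ha hsq)

/-- **The NON-SPLIT cells by squarefree `d`, class by class**, modulo the print obligation:
`(∀ d ≥ 1, ∀ δ ≠ (-1)ⁿ, cell (n, d, δ)) ↔ (∀ squarefree d ≥ 1, ∀ δ ≠ (-1)ⁿ, cell (n, d, δ))` — for
`n = 3` the hypothesis of `nonsplitSixfolds_of_nonsplit_components` (rung R1′ `NonsplitSixfolds`, van
Geemen 5.6 / Markman Thm. 1.5.1), now one norm class at a time (gen 5 re-indexed the rung as a whole).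
[cite: vanGeemen1994HodgeAV, Lemma 5.2 (3) and 5.6] [cite: MoonenZarhin1998WeilClasses, §1] -/
theorem forall_nonsplit_components_iff_squarefree (H : HyperplanePullbackAlongIsogeny) (n : ℕ) :
    (∀ (d : ℕ), 0 < d → ∀ δ : weilNormResidueGroup d, δ ≠ splitDiscriminantClass n d →
        WeilClassesComponent n d δ) ↔
      ∀ (d : ℕ), 0 < d → Squarefree d → ∀ δ : weilNormResidueGroup d, δ ≠ splitDiscriminantClass n d →
        WeilClassesComponent n d δ := by
  refine ⟨fun h d hd _ => h d hd, fun h d hd δ hδ => ?_⟩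
  obtain ⟨a, b, ha, hb, rfl, hsq⟩ := Nat.sq_mul_squarefree_of_pos hd
  exact weilClassesComponent_sq_mul H hb.ne' ha
    (h a ha hsq _ fun hs => hδ ((weilNormResidueGroupCongr_eq_split_iff hb.ne').1 hs))

/-! ### The fourfold residual: R1 (all `d`) ↔ R1′ (squarefree `d`) -/

/-- **The squarefree fourfold residual R1′ gives back R1, modulo the print obligation and the two refereed
sixfold facts** (Koike 2004: `d₀ = 1`; Schoen 1998: `d₀ = 3` — both columns go up the squares FREE of the
obligation, gen 4 `weilClassesComponent_two_sq_mul_of_weilAlgebraicAll`); every other cell `(2, b²d₀, δ)`,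
`δ` non-split, is the cell `(2, d₀, congr δ)`, `congr δ` non-split. Compare gen 4's
`weilFourfoldResidual_of_refereed_and_residualSq` (through Landherr, Markman 2023 and Lemma 5.2 (1)
instead of the print obligation). `HC_CM` absent; research route, not a corollary.
[cite: Koike2004WeilHodge, Rem. 2.1] [cite: Schoen1998HodgeWeilAddendum, §10]
[cite: vanGeemen1994HodgeAV, Lemma 5.2 (3)] -/
theorem weilFourfoldResidual_of_residualSq (H : HyperplanePullbackAlongIsogeny)
    (hK : Koike2004_weilClasses_algebraic_hyperbolicSixfold_one)
    (hS : Schoen1998_weilClasses_algebraic_hyperbolicSixfold_three)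
    (hR : WeilFourfoldResidualSq) : WeilFourfoldResidual := by
  intro d hd h1 h3 δ hδ
  obtain ⟨a, b, ha, hb, rfl, hsq⟩ := Nat.sq_mul_squarefree_of_pos hd
  by_cases ha1 : a = 1
  · subst ha1
    exact weilClassesComponent_two_sq_mul_of_weilAlgebraicAll hb.ne'
      (weilAlgebraicAll_two_of_floorSlice one_pos hK) δ
  by_cases ha3 : a = 3
  · subst ha3
    exact weilClassesComponent_two_sq_mul_of_weilAlgebraicAll hb.ne'
      (weilAlgebraicAll_two_of_floorSlice (by norm_num) hS) δ
  exact weilClassesComponent_sq_mul H hb.ne' ha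
    (hR a ha hsq ha1 ha3 _ fun hs => hδ ((weilNormResidueGroupCongr_eq_split_iff hb.ne').1 hs))

/-- **R1 ↔ R1′**: the fourfold residual over all `d ∉ {1, 3}` and over squarefree `d ∉ {1, 3}` are
EQUIVALENT, granted the print obligation `HyperplanePullbackAlongIsogeny` and the refereed facts of Koike
and Schoen (all hypotheses; nothing asserted). [cite: Koike2004WeilHodge, Rem. 2.1]
[cite: Schoen1998HodgeWeilAddendum, §10] [cite: vanGeemen1994HodgeAV, Lemma 5.2 (3)] -/
theorem weilFourfoldResidual_iff_residualSq (H : HyperplanePullbackAlongIsogeny)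
    (hK : Koike2004_weilClasses_algebraic_hyperbolicSixfold_one)
    (hS : Schoen1998_weilClasses_algebraic_hyperbolicSixfold_three) :
    WeilFourfoldResidual ↔ WeilFourfoldResidualSq :=
  ⟨weilFourfoldResidualSq_of_weilFourfoldResidual, weilFourfoldResidual_of_residualSq H hK hS⟩

end Summit.HodgeConjecture.HodgeConjecture.Ring2.AbelianAll

end
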